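import Mathlib
import HarnessLib
import HarnessLib.Audit
import Summits.QuantumFields.Statement
import Summits.QuantumFields.YangMills.Theses.UnitScaleTilt
import Summits.QuantumFields.YangMills.Theses.CovariantDischarge
import Literature.MathematicalPhysics.QuantumFieldTheory.Balaban1983to89.T3YM3TorusStatement
import Literature.MathematicalPhysics.QuantumFieldTheory.Balaban1983to89.WilsonLoopLimit
import HarnessLib.Audit.Status.Attr

/-!
Route: RandomisedStokes

# Route RandomisedStokes — Averaged-plaquette tails at every informative depth from rectangle tails
plus colour-randomised chaos suppression

LINE 18 of ideator seat ym-r3-idea-2 (g8, lens «nearmiss»; bears_on LADDER-YM rung R3 = leaf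
`T3YM3TorusStatement.YM3TorusSU2` via crux
stmt-QuantumFields-19936 `UnitScaleTilt.HistoryTailL`; no summit and no rung is proved by this
line). It suffices to show X = X₁ ∧ X₂ ∧ X₃:
X₁ (ChaosSuppressedDominationL, deciding, new) — GIVEN that all contractible finest rectangles up to
scale R·L^i carry the profile flatness
η√(L^i/L^j), the j-fold averaged plaquette exceeds the first-order (telescoped) bound D(j+1)η only
with Gibbs mass ≤ C β_K^A exp(−(cη/g_h²)^α),
g_h² = γL^(−(K−j)) — the second-order BCH chaos of the correction insertions is suppressed because
their su(2) directions decorrelate along a side;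
X₂ (RectangleTailL, shared with LINE 17) the stretched-exponential perimeter-law tail of one finest
rectangle; X₃ (ThinDeepWindowTailL, residual, new
and thin) the organ-class first-exit tail ONLY on the sliver of levels (j+1)^N > p(g_h) (N ≤ p₀),
where finest rectangles stop being informative
(UV logarithm × (j+1)³ exceeds p(g_h)²) — a window implied by, and much thinner than, the shared
linear window K < N₁j of stmt-22892.
Lean: `ChaosSuppressedDominationL ∧ RectangleTailL ∧ ThinDeepWindowTailL`

## Assembly
Pure logic on top of the parent route: `UnitScaleTilt.closes h200 h201 (hGlue hRect hChaos hThin)` —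
the glue item turns the three tail cruxes into
`UnitScaleTilt.HistoryTailL`, and the parent's deciding theorem with the two untouched RegPr
residuals gives the rung leaf (not the summit Statement).

CLOSES_TARGET: closes rung R3 of QuantumFields: Literature.MathematicalPhysics.QuantumFieldTheory.Balaban1983to89.T3YM3TorusStatement.YM3TorusSU2 (D-0061; not the summit Statement) — the deciding theorem of this route concludes that registered leaf instead of the Statement decl `YangMills` (class rung: servable and labelled, never counted as concluding the summit Statement).

Rationale: WHY THIS LINE. Near-miss harvested: the tree's own bounded-depth theorem
`HistoryTailBoundedHeightLocal.perPlaquette_boundedHeight_uniform` proves the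
per-plaquette schema with the MEASURED deficit c = ¼Λ^(−2j₀), Λ = 151L², because its footprint is
made of fine PLAQUETTES (area scaling: the
threshold must shrink by Λ per level). LINE 17 replaces the footprint by fine RECTANGLES (perimeter
scaling: thresholds shrink by √L per level) but
pays with a deterministic side condition √(L^j)(j+1)η ≤ η₀ forced by the spiral worst case
j^(3/2)η²√(L^j) of the BCH area term. THIS line makes
that single deficit the crux: the area term is a degree-2 chaos ½Σ_(k<l)[X_k, X_l] in the insertion
fluxes; its ℓ²-operator norm is Σ_k|X_k|² ≈ 4jη²
(not the ℓ^∞ row sum η²√(L^j)), so for colour-isotropic, weakly dependent insertions a Hanson–Wright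
bound gives mass exp(−c/η)·, and the cheapest
conspiracy (direction coherence over ≈ √(p/((j+1)g_h)) consecutive insertions at typical magnitudes)
costs exp(−c√(η)/g_h) — hence the stated
rate with a free stretched exponent ([ChatterjeeYMProb2019] §4 for the loop calculus; decoupling:
arXiv:1602.01222 App.; Bałaban's (0.4) unrolling
[Balaban1987RG1]). Gain over LINE 17: no side condition, so rectangles are used at EVERY depth where
they are informative and the organ residual
shrinks from the linear window K < 3j to the polynomial sliver (j+1)^N > p(g_h) (N chosen by the
glue from the two stretched exponents, p₀ ≥ N).
Imported area: decoupling / Gaussian chaos (Hanson–Wright, de la Peña–Giné) with an explicit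
dictionary: insertion flux X_k ↦ sub-Gaussian vector,
BCH area form ↦ the chaos matrix (c_kl s_k s_l), flatness profile ↦ the ψ₂-norms s_k =
η√(L^(i_k)/L^j).

RANKED CRUXES. #2 ChaosSuppressedDominationL (crux) — For every L there are D ≥ 1, R ≥ 2, α, c > 0,
C, A with: for every F (F.L = L), 0 < γ ≤ 1, K, j ≤ K, level-j plaquette q and 0 < η ≤ 1: Gibbs_K(
[every contractible rectangle with a+b ≤ R·L^i, i ≤ j, has dist1(hol) ≤ η√(L^i/L^j)] ∧ D(j+1)η <
dist1(Ū^j(∂q)) ) ≤ C·β_K^A·exp(−(c·η/(γL^(−(K−j))))^α). Empty event below the deterministic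
threshold η ≲ L^(−j/2)/√j (LINE 17's lemma); content = suppression of the second-order insertion
chaos above it. [difficulty: XL] (why it might fail: Insertion-flux directions along a side are
correlated through the massless background (F–F correlations decay only like r⁻³); a coherent colour
texture over √(p/((j+1)g_h)) insertions may be cheaper than exp(−(cη/g_h²)^α) for every α, or
magnitudes and directions may conspire jointly.) [ChatterjeeYMProb2019, Balaban1987RG1,
arXiv:1602.01222, arXiv:2107.04021]
#3 RectangleTailL (crux) — For every L there are α, c > 0, C, A with: for every T3Family F (F.L =
L), 0 < γ ≤ 1, every run K, every contractible lattice rectangle (corner x, directions μ ≠ ν, sides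
a, b ≥ 1, 2(a+b) < sites per direction) and 0 < t ≤ 1: Gibbs_K(t ≤ dist1(hol ∂rect)) ≤
C·β_K^A·(a+b)^A·exp(−(c·t²β_K/((a+b)(1+log(a+b))))^α) — a perimeter-law moderate-deviation bound
with any stretched exponent. [difficulty: XL] (why it might fail: Uniform-in-β moderate deviations
of a mesoscopic SU(2) Wilson loop (perimeter up to o(β)) are not in print; the loop's self-energy
carries the UV log and bulk cubic interactions, so even a stretched exponent needs line-source
cluster-expansion control.) [ChatterjeeYMProb2019, BrydgesFrohlichSeiler1979, arXiv:2107.04021,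
arXiv:1602.01222]
#4 ThinDeepWindowTailL (crux) — RESIDUAL (organ-class, NEW, thin): for every L and N > 0 and
thresholds 0 < b₀ ≤ b₂, p₀ > 2 with N ≤ p₀ there are γ₁, C, c, N' with: for F (F.L = L), 0 < γ ≤ γ₁,
1 ≤ j ≤ K with (j+1)^N > p(g_(K−j)) and every level-j plaquette: Gibbs_K(finer levels θ(b₀)-small ∧
level j θ(b₂)-small ∧ θ(b₀)(K−j) ≤ dist1(Ū^j(∂p))) ≤ C·β_(K−j)^N'·exp(−c·p(g_(K−j))²). Implied by
CovariantDischarge.DeepWindowTailL (the sliver lies in a linear window K < N₁j since N ≤ p₀).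
[difficulty: open-problem] (why it might fail: The sliver still contains the top levels (small
height, (j+1)^N > p(√γ·L^(−h/2))) of arbitrarily deep runs, where Gaussian-profile strength is
exactly Bałaban's unprinted large-field induction; bare fibre convexity is measured dead there (JOB
B).) [Balaban1989LargeFieldII, Balaban1988Convergent, Balaban1985UV3]
#5 FluctuationComparisonRegPrIntL (crux) — Parent residual of route UnitScaleTilt
(stmt-QuantumFields-20520, byte-identical): regulated-pressure fluctuation comparison; untouched by
this line. [difficulty: open-problem] (why it might fail: It is Bałaban's small-field
effective-action comparison between runs K and K+1 with K-uniform constants — printed only inside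
the inductive renormalization scheme, never as a stand-alone pressure statement.) [Balaban1985UV3,
Balaban1988Convergent]
#6 MinimiserStabilityRegPr (crux) — Parent residual of route UnitScaleTilt
(stmt-QuantumFields-19200, byte-identical): stability of the regulated-pressure minimiser; untouched
by this line. [difficulty: open-problem] (why it might fail: Uniform positivity of the background
Hessian along the whole trajectory is Bałaban's variational-problem analysis; a degenerate toron
direction on the 3-torus could violate the stated uniform constant.) [Balaban1985UV3,
Balaban1987RG1]
#9 HistoryTailOfChaosL (support) — Glue: RectangleTailL → ChaosSuppressedDominationL →
ThinDeepWindowTailL → UnitScaleTilt.HistoryTailL. Given L take (α_R,c,C,A) and (D,R,α_X,c',C',A');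
set N = ⌈2 + 2/α_R + 2/α_X⌉, b₀ = max(b₁,1), p₀ ≥ max(p₁, N, 3); for m take γ₁(m) small. Off the
sliver ((j+1)^N ≤ p(g_h), h = K−j): with η = θ(h)/(2D(j+1)) the bad event {θ(h) ≤ dist1(Ū^j(∂q))}
lies in {not profile-flat} ∪ {flat ∧ D(j+1)η < dist1}; the first has mass ≤ Σ over ≤
12(j+1)R²L^(2j)(2L^(m+K))³ rectangles of C β_K^A(RL^j)^A exp(−(c p(g_h)²/(4D²R(j+1)²(1+log R+j log
L)))^(α_R)) (identity θ(h)²β_K/L^j = p(g_h)²), the second ≤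
C'β_K^(A')exp(−(c'p(g_h)/(2D(j+1)g_h))^(α_X)); both beat the (A+4)(m+K+1)log(2L) entropy because
(j+1) ≤ p^(1/N), p^(α(1−3/N)) ≥ p^(1/N) and g_h^(−α_X) = γ^(−α_X/2)L^(α_X h/2). On the sliver use X₃
with the bare tail `unitScaleTilt_bareTail` for the complement; sum with
`real_compl_histGood_le_sum` (first exit). [difficulty: M] [Balaban1985UV3, King1986]

TWO-LAYER PLAN. ChaosSuppressedDominationL ⇐ (deterministic two-term bound: flat ⇒ dist1(Ū^j(∂q)) ≤
D₀(j+1)η + |N_q(U)| with N_q the BCH area functional of the unrolled insertions — LINE 17's algebra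
without side condition) → (chaos tail: Gibbs_K(flat ∧ |N_q| > η) ≤ Cβ^A exp(−(cη/g_h²)^α)) → crux.
ThinDeepWindowTailL ⇐ CovariantDischarge.DeepWindowTailL (window inclusion, support theorem
`thinOfDeep`, provable now).

KILL CRITERIA. Refutation of ChaosSuppressedDominationL (a height/depth family where Gibbs_K(flat ∧
D(j+1)η < dist1) decays slower than every exp(−(cη/g_h²)^α),
e.g. by an explicit coherent colour texture of insertion fluxes with entropy cost o(√η/g_h)) closes
the route (close --reason refuted:ChaosSuppressedDominationL);
LINE 17 survives it. Refutation of RectangleTailL kills both rectangle lines. ThinDeepWindowTailL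
refuted ⇒ DeepWindowTailL (22892) refuted too (it implies the thin one): shared fate with
CovariantDischarge / RectangleDomination.

NOT DECOMPOSED YET. The explicit BCH area functional N_q (menu of insertion loops per level and
offset), the dependence structure of insertion fluxes along a side
(needed ψ₂ / mixing input for a Hanson–Wright inequality under the Gibbs measure), the prefactor
exponents, the first-exit constants — layer 2.

CHEAPEST FALSIFIER. Instrument row L18-A (for idea-crit-5 / engines; kit not held by this seat):
femto lattices L ∈ {2,3}, K ≤ 6, j ∈ {2,3}, Gibbs samples at three γ:
estimate the conditional frequency of {dist1(Ū^j(∂q)) > D(j+1)η} given profile-flatness for a grid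
of η above the deterministic threshold and fit
log(−log freq) against log(η/g_h²): KILL ChaosSuppressedDominationL if the fitted exponent α̂ ≤ 0
(no decay in η/g_h²) or if the frequency is
height-independent. Row L18-B (structural): the direction autocorrelation ⟨x̂_k·x̂_(k+r)⟩ of
transported insertion fluxes along a side; KILL if it
does not decay in r (coherent colour texture typical).

NUMBERS. ℓ²-operator norm of the BCH chaos matrix ≈ Σ_k s_k² = Σ_i 4L^(j−i)·η²L^(i−j) = 4jη² versus
the ℓ^∞ row sum ≈ η²√(L^j) (LINE 17's deterministic
side condition); Hanson–Wright scale t/λ_max = (j+1)η/(4jη²) ≈ 1/(4η); cheapest conspiracy: n ≈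
√(p/(4c(j+1)log L·g_h)) coherent insertions at
typical magnitude g_h√(2cj log L), cost e^(−cn); sliver (j+1)^N > p(g_h) versus linear window K <
3j.

DEFINITION REQUESTS. None: `Missing.rectLoop`, `Missing.pathHol`, `GaugeGroup.dist1`,
`BlockAveraging.blockAvg`, `T3UnitScaleTilt.gibbsK`, `B10.pFun` exist.

Novelty: Searches (2026-08-29): lit search --hybrid "Hanson-Wright inequality dependent random vectors gauge
theory" / "decoupling chaos lattice gauge" (no
gauge-theory hit; decoupling texts only); lit vsearch "second order Baker-Campbell-Hausdorff term of
many small holonomies concentration" (no hit);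
lit galaxy search "Hanson-Wright|gaussian chaos" --star pdf (generic probability hits, none in
lattice gauge theory); ledger negatives --problem
QuantumFields (no chaos/decoupling statement); the seventeen route files of this crux (none isolates
the second-order insertion chaos; LINE 17
bounds it deterministically).
Nearest prior art found: LINE 17 route RectangleDomination (same first-order algebra, deterministic
second order); arXiv:1602.01222 (Chatterjee,
Appendix: concentration tools for lattice gauge theory at the level of the free energy);
route-QuantumFields-RevelationMartingale (martingale
concentration of the averaged plaquette itself, not of the insertion chaos).
Delta: isolates the non-abelian second-order BCH chaos of Bałaban's correction insertions as the
ONLY probabilistic obstacle beyond one-loop tails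
and conjectures its suppression at rate exp(−(cη/g_h²)^α) from colour-direction decorrelation,
removing LINE 17's depth cap and thinning the
organ residual to a polynomial sliver.
Claimed grade: new-combination  [refs: 1602.01222]

Barriers (technique_class: loop-tail, nonabelian-stokes, decoupling-chaos): - technique_class: loop-tail, nonabelian-stokes, decoupling-chaos
- Literature.Barriers.QuantumFields.PerturbativeInvisibility: it does not evade it fully; the bet is
that both inputs are UV/perimeter quantities (one-loop rectangle variance, chaos of lattice-scale
insertion fluxes) — the confinement scale β_K never enters because all loops have perimeter ≤ γ₁β_K.
- Literature.Barriers.QuantumFields.ElitzurTheorem: evaded — rectangle holonomies, dist1(Ū^j(∂q))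
and the flat ∧ bad event are gauge invariant; the "directions" heuristic is stated only inside the
docstring, the crux quantifies over gauge-invariant events.
- Literature.Barriers.QuantumFields.ToronPlaneAnticorrelation: evaded — no correlation inequality or
positivity of plaquette–plaquette covariances is used; contractible loops do not see torons.
- Literature.Barriers.QuantumFields.UVStabilityNonUniqueness: not engaged — no effective action or
minimiser; the residual X₃ carries the organ-class part explicitly and is thinner than every listed
window.
- Negatives index: stmt 26948/26997 (uniform sup level-shift), 28261, 18944, 16181, 15826 — none is
a loop-tail, chaos or domination statement; no sup-density bound is asserted.

History (route lifecycle, newest last):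
- 2026-08-29T00:50:45Z · rev 1: restated ThinDeepWindowTailL (stmt-QuantumFields-23886) — repair (critic idea-crit-5 #209, class misstated): in 23886 the inner prefactor binder ∃(N : ℕ) shadowed the outer sliver exponent N, so the window (j+1)^N > p( (planner-ym-r3-idea-2-g8-0)

sub-problem: YangMills · status: open · opened planner-ym-r3-idea-2-g8-0 2026-08-29T00:34:29Z · rev 1 · ledger route-QuantumFields-RandomisedStokes
GENERATED by the gate from the ledger (D-0016/17). Provers cite these decls: `theorem foo : Summit.QuantumFields.YangMills.Theses.RandomisedStokes.<Decl> := …` in Summits/QuantumFields/YangMills/Theorems/<Name>.lean.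
-/

namespace Summit.QuantumFields.YangMills.Theses.RandomisedStokes

open scoped BigOperators Topology Manifold Classical MeasureTheory ProbabilityTheory Matrix InnerProductSpace ComplexConjugate ContinuousMap
open Filter Set Function TopologicalSpace MeasureTheory

attribute [summit_statement] _root_.YangMills
attribute [summit_statement] _root_.Literature.MathematicalPhysics.QuantumFieldTheory.Balaban1983to89.T3YM3TorusStatement.YM3TorusSU2

/-- item stmt-QuantumFields-23885 · crux · rank 2 · open · by planner
why it might fail: Insertion-flux directions along a side are correlated through the massless background (F–F correlations decay only like r⁻³); a coherent colour texture over √(p/((j+1)g_h)) insertions may be cheaper than exp(−(cη/g_h²)^α) for every α, or magnitudes and directions may conspire jointly.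
sources: ChatterjeeYMProb2019, Balaban1987RG1, arXiv:1602.01222, arXiv:2107.04021
[crux] For every L there are D ≥ 1, R ≥ 2, α, c > 0, C, A with: for every F (F.L = L), 0 < γ ≤ 1, K,
j ≤ K, level-j plaquette q and 0 < η ≤ 1: Gibbs_K( [every contractible rectangle with a+b ≤ R·L^i, i
≤ j, has dist1(hol) ≤ η√(L^i/L^j)] ∧ D(j+1)η < dist1(Ū^j(∂q)) ) ≤
C·β_K^A·exp(−(c·η/(γL^(−(K−j))))^α). Empty event below the deterministic threshold η ≲ L^(−j/2)/√j
(LINE 17's lemma); content = suppression of the second-order insertion chaos above it. [difficulty: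
XL] -/
@[route_item "route-QuantumFields-RandomisedStokes", crux]
def ChaosSuppressedDominationL : Prop :=
  open Literature.MathematicalPhysics.QuantumFieldTheory.Balaban1983to89 Literature.MathematicalPhysics.QuantumFieldTheory.Balaban1983to89.T3ContinuumYM3Torus in ∀ (L : ℕ), ∃ (D R α c C : ℝ) (A : ℕ), 1 ≤ D ∧ 2 ≤ R ∧ 0 < α ∧ 0 < c ∧ 0 ≤ C ∧ ∀ (F : T3Family) (γ : ℝ), F.L = L → 0 < γ → γ ≤ 1 → ∀ (K j : ℕ) (q : Plaq (F.P K) j) (η : ℝ), j ≤ K → 0 < η → η ≤ 1 → (T3UnitScaleTilt.gibbsK F T3UnitLawDensityEML.ℰp γ K).real {U | (∀ (i a b : ℕ) (x : Site (F.P K) 0) (μ ν : Fin (F.P K).d), μ ≠ ν → i ≤ j → 1 ≤ a → 1 ≤ b → 2 * (a + b) < (F.P K).sitesPerDir 0 → ((a : ℝ) + b) ≤ R * (L : ℝ) ^ i → GaugeGroup.dist1 (Missing.pathHol U (Missing.rectLoop x μ ν a b)) ≤ η * Real.sqrt ((L : ℝ) ^ i / (L : ℝ) ^ j)) ∧ D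 * ((j : ℝ) + 1) * η < GaugeGroup.dist1 (GaugeField.plaqHol (Averaging.iter (fun i => BlockAveraging.blockAvg (P := F.P K) (j := i) T3UnitLawDensityEML.ℰp) j U) q)} ≤ C * (F.scheme T3UnitLawDensityEML.ℰp γ).β K ^ A * Real.exp (-((c * (η / (γ * ((L : ℝ)⁻¹) ^ (K - j)))) ^ α))

/-- item stmt-QuantumFields-23864 · crux · rank 3 · open · by planner
why it might fail: Uniform-in-β moderate deviations of a mesoscopic SU(2) Wilson loop (perimeter up to o(β)) are not in print; the loop's self-energy carries the UV log and bulk cubic interactions, so even a stretched exponent needs line-source cluster-expansion control.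
sources: ChatterjeeYMProb2019, BrydgesFrohlichSeiler1979, arXiv:2107.04021, arXiv:1602.01222
[crux] For every L there are α, c > 0, C, A with: for every T3Family F (F.L = L), 0 < γ ≤ 1, every
run K, every contractible lattice rectangle (corner x, directions μ ≠ ν, sides a, b ≥ 1, 2(a+b) <
sites per direction) and 0 < t ≤ 1: Gibbs_K(t ≤ dist1(hol ∂rect)) ≤
C·β_K^A·(a+b)^A·exp(−(c·t²β_K/((a+b)(1+log(a+b))))^α) — a perimeter-law moderate-deviation bound
with any stretched exponent. [difficulty: XL] -/
@[route_item "route-QuantumFields-RandomisedStokes", crux]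
def RectangleTailL : Prop :=
  open Literature.MathematicalPhysics.QuantumFieldTheory.Balaban1983to89 Literature.MathematicalPhysics.QuantumFieldTheory.Balaban1983to89.T3ContinuumYM3Torus in ∀ (L : ℕ), ∃ (α c C : ℝ) (A : ℕ), 0 < α ∧ 0 < c ∧ 0 ≤ C ∧ ∀ (F : T3Family) (γ : ℝ), F.L = L → 0 < γ → γ ≤ 1 → ∀ (K a b : ℕ) (x : Site (F.P K) 0) (μ ν : Fin (F.P K).d) (t : ℝ), μ ≠ ν → 1 ≤ a → 1 ≤ b → 2 * (a + b) < (F.P K).sitesPerDir 0 → 0 < t → t ≤ 1 → (T3UnitScaleTilt.gibbsK F T3UnitLawDensityEML.ℰp γ K).real {U | t ≤ GaugeGroup.dist1 (Missing.pathHol U (Missing.rectLoop x μ ν a b))} ≤ C * (F.scheme T3UnitLawDensityEML.ℰp γ).β K ^ A * ((a : ℝ) + b) ^ A * Real.exp (-((c * (t ^ 2 * (F.scheme T3UnitLawDensityEML.ℰp γ).β K / (((a : ℝ) + b) * (1 + Real.log ((a : ℝ) + b))))) ^ α))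

-- earlier ThinDeepWindowTailL (stmt-QuantumFields-23886, replaced 2026-08-29T00:50:45Z -> stmt-QuantumFields-23919): retired by None — open Literature.MathematicalPhysics.QuantumFieldTheory.Balaban1983to89 Literature.MathematicalPhysics.QuantumFieldTheory.Balaban1983to89.T3ContinuumYM3Torus in ∀ (L N : ℕ), 0 < N → ∀ (b₀ p₀ b₂ : ℝ), 0 < b₀ → 2 < p₀ → (N : ℝ) ≤ p₀ → b₀ ≤ b₂ → ∃ (γ₁ C c : ℝ) (N : ℕ), 0
/-- item stmt-QuantumFields-23919 · crux · rank 4 · open · by planner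
why it might fail: Residual of organ class (Balaban small-field UV stability of the effective law) restricted to the sliver (j+1)^N > p(g_h), N ≤ p₀; implied by stmt-22892's linear window, open in print beyond bounded height.
sources: Balaban1985UV3
[crux] RESIDUAL (organ-class, NEW, thin): for every L and N > 0 and thresholds 0 < b₀ ≤ b₂, p₀ > 2
with N ≤ p₀ there are γ₁, C, c, N' with: for F (F.L = L), 0 < γ ≤ γ₁, 1 ≤ j ≤ K with (j+1)^N >
p(g_(K−j)) and every level-j plaquette: Gibbs_K(finer levels θ(b₀)-small ∧ level j θ(b₂)-small ∧
θ(b₀)(K−j) ≤ dist1(Ū^j(∂p))) ≤ C·β_(K−j)^N'·exp(−c·p(g_(K−j))²). Implied by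
CovariantDischarge.DeepWindowTailL (the sliver lies in a linear window K < N₁j since N ≤ p₀).
[difficulty: open-problem] -/
@[route_item "route-QuantumFields-RandomisedStokes", crux]
def ThinDeepWindowTailL : Prop :=
  open Literature.MathematicalPhysics.QuantumFieldTheory.Balaban1983to89 Literature.MathematicalPhysics.QuantumFieldTheory.Balaban1983to89.T3ContinuumYM3Torus in ∀ (L N : ℕ), 0 < N → ∀ (b₀ p₀ b₂ : ℝ), 0 < b₀ → 2 < p₀ → (N : ℝ) ≤ p₀ → b₀ ≤ b₂ → ∃ (γ₁ C c : ℝ) (N' : ℕ), 0 < γ₁ ∧ γ₁ ≤ 1 ∧ 0 < c ∧ ∀ (F : T3Family) (γ : ℝ), F.L = L → 0 < γ → γ ≤ γ₁ → ∀ (K j : ℕ), 1 ≤ j → j ≤ K → ((j : ℝ) + 1) ^ N > B10.pFun b₀ p₀ (Real.sqrt (γ * ((F.L : ℝ)⁻¹) ^ (K - j))) → ∀ p : Plaq (F.P K) j, (T3UnitScaleTilt.gibbsK F T3UnitLawDensityEML.ℰp γ K).real {U | (∀ k, k < j → PlaqSmall (T3UnitScaleTilt.θBal F.L γ b₀ p₀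 (K - k)) (Averaging.iter (fun i => BlockAveraging.blockAvg (P := F.P K) (j := i) T3UnitLawDensityEML.ℰp) k U)) ∧ PlaqSmall (T3UnitScaleTilt.θBal F.L γ b₂ p₀ (K - j)) (Averaging.iter (fun i => BlockAveraging.blockAvg (P := F.P K) (j := i) T3UnitLawDensityEML.ℰp) j U) ∧ T3UnitScaleTilt.θBal F.L γ b₀ p₀ (K - j) ≤ GaugeGroup.dist1 (GaugeField.plaqHol (Averaging.iter (fun i => BlockAveraging.blockAvg (P := F.P K) (j := i) T3UnitLawDensityEML.ℰp) j U) p)} ≤ C * ((γ * ((F.L : ℝ)⁻¹) ^ (K - j))⁻¹) ^ N' * Real.exp (-(c * B10.pFun b₀ p₀ (Real.sqrt (γ * ((F.L : ℝ)⁻¹) ^ (K - j))) ^ 2))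

/-- item stmt-QuantumFields-20520 · crux · rank 5 · open · by operator
why it might fail: It is Bałaban's small-field effective-action comparison between runs K and K+1 with K-uniform constants — printed only inside the inductive renormalization scheme, never as a stand-alone pressure statement.
sources: Balaban1985UV3, Balaban1988Convergent
[crux] K1b-INT (E-INT interior excision of FluctuationComparisonRegPrL, OWNER RULING g22-№3 §B +
ADDENDUM 1; card C8 `edge-band-to-the-tail`): for every L there are an EXCISION RATIO 0 < c ≤ 1 and
THRESHOLDS (b₁, p₁) such that for every profile (b₀, p₀) with b₁ ≤ b₀, p₁ ≤ p₀, 0 < b₀, 2 < p₀ there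
is ε₁ > 0 such that for every 0 < ε₀ ≤ ε₁ there is m₀ such that for every m ≥ m₀ there is a
volume-uniform γ₁ > 0 such that for every T3Family F with F.L = L and 0 < γ ≤ γ₁,
`T3InteriorExcision.FluctuationComparisonRegPrIntAt F γ b₀ p₀ m c ε₀`: a.e. on the SHRUNK window
`PlaqSmall (θBal L γ (c·b₀) p₀ (K/m))` both restricted height densities of runs K and K+1 on the
histGood events at the ORIGINAL profile (b₀, p₀) are positive and log ρ + β·minActionRegPr of the
two runs agree modulo constants κ_K up to summable r_K (same body as FluctuationComparisonRegPrAt;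
only the a.e. guard is the c-window). FORMALLY WEAKER than FluctuationComparisonRegPrL (c = 1;
window monotone in b₀: `θBal_mono_b`), NO edge clause (the band {θ(c·b₀)-large, θ(b₀)-small} is
charged to HistoryTailL, whose profile floor absorbs the rescaling:
`T3InteriorExcision.unitTiltTail_of_interior`), and on the c-window print's χ -/
@[route_item "route-QuantumFields-RandomisedStokes", crux]
def FluctuationComparisonRegPrIntL : Prop :=
  open Literature.MathematicalPhysics.QuantumFieldTheory.Balaban1983to89 Literature.MathematicalPhysics.QuantumFieldTheory.Balaban1983to89.T3ContinuumYM3Torus in ∀ (L : ℕ), ∃ (c b₁ p₁ : ℝ), 0 < c ∧ c ≤ 1 ∧ ∀ (b₀ p₀ : ℝ), b₁ ≤ b₀ → p₁ ≤ p₀ → 0 < b₀ → 2 < p₀ → ∃ ε₁ : ℝ, 0 < ε₁ ∧ ∀ (ε₀ : ℝ), 0 < ε₀ → ε₀ ≤ ε₁ → ∃ m₀ : ℕ, ∀ (m : ℕ), m₀ ≤ m → ∃ γ₁ : ℝ, 0 < γ₁ ∧ ∀ (F : T3Family) (γ : ℝ), F.L = L → 0 < γ → γ ≤ γ₁ → T3InteriorExcision.FluctuationComparisonRegPrIntAt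 F γ b₀ p₀ m c ε₀

/-- item stmt-QuantumFields-19200 · crux · rank 6 · open · by operator
why it might fail: Uniform positivity of the background Hessian along the whole trajectory is Bałaban's variational-problem analysis; a degenerate toron direction on the 3-torus could violate the stated uniform constant.
sources: Balaban1985UV3, Balaban1987RG1
[crux] K1aR-pr (E-min at the minimum over PRINT'S regular space (6) of Balaban1985Variational IN
FULL — both clauses of (2): small plaquette variables AND small covariant divergence
Balaban1985RegularSpaces (1.9); replaces MinimiserStability stmt-QuantumFields-19822; supersedes
children-v2's plaquette-only MinimiserStabilityReg, which needed the unprinted gap G-K1aR-1 on top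
of [7] Thm 1) — for every block size L there is ε₁(L) > 0 (the uniqueness radius a₀ of
Balaban1985Variational Thm 1, «depends on d and L only») such that for every 0 < ε₀ ≤ ε₁, all
sufficiently large m ≥ m₀(L, ε₀), every profile (b₀, p₀) and all 0 < γ ≤ γ₁(L, ε₀, m, b₀, p₀), every
T3Family F with F.L = L: `MinimiserStabilityRegPrAt F γ b₀ p₀ m ε₀` (tree module
`T3PrintedRegularMinimiser` = `BgStabilityAt` at the printed backgrounds `bgRegPr`/`bgRegPr'`) —
summable r_K ≥ 0 and constants κ_K with, for every K and EVERY θBal(⌊K/m⌋)-small field V on the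
comparison lattice, |β_{K+1}·minActionRegPr_{K+1}(V) − β_K·minActionRegPr_K(V) − κ_K| ≤ r_K (κ
idle), where minActionRegPr_K(V) = inf of the Wilson action over run K's fibre of V ∩ {|U(∂p) − 1| <
ε₀L^{-2(K−⌊K/m⌋)} ∀p} ∩ {‖(D^{1*}_U ∂U)(b)‖ < ε₀L^{-3(K−⌊K/m⌋)} ∀b} (d -/
@[route_item "route-QuantumFields-RandomisedStokes", crux]
def MinimiserStabilityRegPr : Prop :=
  open Literature.MathematicalPhysics.QuantumFieldTheory.Balaban1983to89 Literature.MathematicalPhysics.QuantumFieldTheory.Balaban1983to89.T3ContinuumYM3Torus in ∀ (L : ℕ), ∃ ε₁ : ℝ, 0 < ε₁ ∧ ∀ (ε₀ : ℝ), 0 < ε₀ → ε₀ ≤ ε₁ → ∃ m₀ : ℕ, ∀ (m : ℕ), m₀ ≤ m → ∀ (b₀ p₀ : ℝ), 0 < b₀ → 2 < p₀ → ∃ γ₁ : ℝ, 0 < γ₁ ∧ ∀ (F : T3Family) (γ : ℝ), F.L = L → 0 < γ → γ ≤ γ₁ → T3PrintedRegularMinimiser.MinimiserStabilityRegPrAt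 F γ b₀ p₀ m ε₀

/-- item stmt-QuantumFields-23887 · support · rank 9 · closed · proved by Summit.QuantumFields.YangMills.Theorems.RandomisedStokesHistoryTailOfChaos.randomisedStokes_historyTailOfChaosL_proof (prover) · by planner
sources: Balaban1985UV3, King1986
[support] Glue: RectangleTailL → ChaosSuppressedDominationL → ThinDeepWindowTailL →
UnitScaleTilt.HistoryTailL. Given L take (α_R,c,C,A) and (D,R,α_X,c',C',A'); set N = ⌈2 + 2/α_R +
2/α_X⌉, b₀ = max(b₁,1), p₀ ≥ max(p₁, N, 3); for m take γ₁(m) small. Off the sliver ((j+1)^N ≤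
p(g_h), h = K−j): with η = θ(h)/(2D(j+1)) the bad event {θ(h) ≤ dist1(Ū^j(∂q))} lies in {not
profile-flat} ∪ {flat ∧ D(j+1)η < dist1}; the first has mass ≤ Σ over ≤ 12(j+1)R²L^(2j)(2L^(m+K))³
rectangles of C β_K^A(RL^j)^A exp(−(c p(g_h)²/(4D²R(j+1)²(1+log R+j log L)))^(α_R)) (identity
θ(h)²β_K/L^j = p(g_h)²), the second ≤ C'β_K^(A')exp(−(c'p(g_h)/(2D(j+1)g_h))^(α_X)); both beat the
(A+4)(m+K+1)log(2L) entropy because (j+1) ≤ p^(1/N), p^(α(1−3/N)) ≥ p^(1/N) and g_h^(−α_X) =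
γ^(−α_X/2)L^(α_X h/2). On the sliver use X₃ with the bare tail `unitScaleTilt_bareTail` for the
complement; sum with `real_compl_histGood_le_sum` (first exit). [difficulty: M] -/
@[route_item "route-QuantumFields-RandomisedStokes", crux]
def HistoryTailOfChaosL : Prop :=
  RectangleTailL → ChaosSuppressedDominationL → ThinDeepWindowTailL → Summit.QuantumFields.YangMills.Theses.UnitScaleTilt.HistoryTailL

-- `HistoryTailOfChaosL` holds: proved by `Summit.QuantumFields.YangMills.Theorems.RandomisedStokesHistoryTailOfChaos.randomisedStokes_historyTailOfChaosL_proof` (its module imports this route file, so no `_holds` link can be stated here).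

/-- item stmt-QuantumFields-23888 · assembly · rank 1 · closed · proved by Summit.QuantumFields.YangMills.Theorems.randomisedStokes_assembly_proof (prover) · by planner
sources: Balaban1985UV3, King1986
[assembly] MinimiserStabilityRegPr → FluctuationComparisonRegPrIntL → RectangleTailL →
ChaosSuppressedDominationL → ThinDeepWindowTailL → HistoryTailOfChaosL → YM3TorusSU2 (rung R3). -/
@[route_item "route-QuantumFields-RandomisedStokes"]
def Assembly : Prop :=
  MinimiserStabilityRegPr → FluctuationComparisonRegPrIntL → RectangleTailL → ChaosSuppressedDominationL → ThinDeepWindowTailL → HistoryTailOfChaosL → Literature.MathematicalPhysics.QuantumFieldTheory.Balaban1983to89.T3YM3TorusStatement.YM3TorusSU2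

-- `Assembly` holds: proved by `Summit.QuantumFields.YangMills.Theorems.randomisedStokes_assembly_proof` (its module imports this route file, so no `_holds` link can be stated here).

/-! D-0027 §2.1 — DECIDING THEOREM (planner-authored via `route open/edit --closes-file`; by planner-ym-r3-idea-2-g8-0 2026-08-29T00:34:29Z):
its hypotheses are this route's items and its conclusion the registered leaf `Literature.MathematicalPhysics.QuantumFieldTheory.Balaban1983to89.T3YM3TorusStatement.YM3TorusSU2` (rung R3, D-0061) (glue_lint), and it elaborates with this file. -/

@[closes "route-QuantumFields-RandomisedStokes"] theorem closes (h200 : MinimiserStabilityRegPr) (h201 : FluctuationComparisonRegPrIntL) (hR : RectangleTailL)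
    (hX : ChaosSuppressedDominationL) (hT : ThinDeepWindowTailL) (hG : HistoryTailOfChaosL) :
    Literature.MathematicalPhysics.QuantumFieldTheory.Balaban1983to89.T3YM3TorusStatement.YM3TorusSU2 :=
  Summit.QuantumFields.YangMills.Theses.UnitScaleTilt.closes h200 h201 (hG hR hX hT)

end Summit.QuantumFields.YangMills.Theses.RandomisedStokes
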